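import Summits.HubbardSuperconductivity.HubbardSuperconductivity.Theorems.SeamInductionAdditiveWidthInduction
import Summits.HubbardSuperconductivity.HubbardSuperconductivity.Theorems.WidthHaldaneTubeBlochBound

/-!
# A floored MULTIPLICATIVE one-seam locality also runs the width induction of route `SeamInduction`

Companion of `SeamInductionAdditiveWidthInduction.lean` (stmt-HubbardSuperconductivity-16312, the
target of route `SeamInduction`, from RESTATED cruxes). The second candidate repair of the misstated
crux `SeamGluingLocality` (stmt-18509) keeps its multiplicative boundary factors `1 ∓ M₂/M` but claims
them only for parts FLOORED by `(d, k)` (`d ≤ ρ̃`, `d ≤ ẽ″ ≤ k` on both parts), with `M₂, L₂` free to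
depend on `(U, δ, d, k)` (the guarded shape "C‴" of the prover / refuter verdict notes on stmt-18509).

* `condAdditive_of_flooredMultiplicative` — abstractly, if `ρ ≤ R` a priori then the floored
  multiplicative comparisons imply the ADDITIVE ones with `C = M₂·max(R, k)`:
  `(1 − M₂/M)·min ≥ min − (M₂/M)·R`, `(1 ∓ M₂/M)·(min | max) ≷ (min | max) ∓ (M₂/M)·k`.
* `uniformThermo_of_uniformConstants_of_flooredGluing` — over the tube names, pointwise in `(U, δ)`:
  Bloch's bound `ρ̃_{L,M} ≤ 2` (`tubeStiffness_le_two`, `L ≥ 3`) supplies `R = 2`, so uniform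
  constants per width plus floored multiplicative locality give `UniformThermo` (via the additive
  induction `uniformThermo_of_uniformConstants_of_condAdditive`).
* `seamInduction_widthUniformThermodynamics_of_uniformConstants_of_flooredGluing` — the target
  stmt-16312 (`SeamInduction` copy) from `UniformConstantsPerWidth` and the floored multiplicative
  locality.

So the additive conditional locality is the WEAKER (safer) of the two restatement shapes, and either
choice by the tenure planner is already glued to the target in the tree. Real arithmetic only; no
definitions, no named facts.
-/

noncomputable section

namespace Summit.HubbardSuperconductivity.HubbardSuperconductivity.Theorems.WidthUniformThermodynamics

set_option linter.dupNamespace false -- summit = problem name (single-conjunct summit), D-0017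

open scoped BigOperators Classical Matrix
open Summit.HubbardSuperconductivity.HubbardSuperconductivity.Theorems.WidthHaldane
open Summit.HubbardSuperconductivity.HubbardSuperconductivity.Theses.WidthHaldane
  (WidthUniformThermodynamics)

/-! ### Floored multiplicative locality implies additive locality -/

/-- **A floored multiplicative one-seam locality is an additive one.** If `ρ ≤ R` a priori on the
parts, then boundary factors `1 ∓ M₂/M` on parts floored by `(d', k')` (`d' ≤ ρ`, `d' ≤ κ ≤ k'` on
both parts; `0 < d'`) give the additive comparisons with the constant `C = M₂ · max(R, k')`:
`(1 − M₂/M)·min(ρ', ρ'') ≥ min − (M₂/M)·R`, `(1 − M₂/M)·min(κ', κ'') ≥ min − (M₂/M)·k'`,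
`(1 + M₂/M)·max(κ', κ'') ≤ max + (M₂/M)·k'`. [folklore] -/
theorem condAdditive_of_flooredMultiplicative
    (ρ κ : ∀ (L M : ℕ) [NeZero L] [NeZero M] (Λ : Type) [LinearOrder Λ] [Fintype Λ],
      (Λ ≃ ZMod L × ZMod M) → ℝ)
    {R d' k' : ℝ} (hd' : 0 < d') (M₂ L₂ : ℕ)
    (hR : ∀ (L M : ℕ) [NeZero L] [NeZero M], M₂ ≤ M → L₂ ≤ L →
      ∀ (Λ : Type) [LinearOrder Λ] [Fintype Λ] (e : Λ ≃ ZMod L × ZMod M), ρ L M Λ e ≤ R)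
    (hB : ∀ (L M' M'' M : ℕ) [NeZero L] [NeZero M'] [NeZero M''] [NeZero M],
      Even L → Even M' → Even M'' → M₂ ≤ M' → M₂ ≤ M'' → M' + M'' = M → M ≤ L → L₂ ≤ L →
        ∀ (Λ' : Type) [LinearOrder Λ'] [Fintype Λ'] (e' : Λ' ≃ ZMod L × ZMod M')
          (Λ'' : Type) [LinearOrder Λ''] [Fintype Λ''] (e'' : Λ'' ≃ ZMod L × ZMod M'')
          (Λ : Type) [LinearOrder Λ] [Fintype Λ] (e : Λ ≃ ZMod L × ZMod M),
          d' ≤ ρ L M' Λ' e' → d' ≤ ρ L M'' Λ'' e'' → d' ≤ κ L M' Λ' e' →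
          d' ≤ κ L M'' Λ'' e'' → κ L M' Λ' e' ≤ k' → κ L M'' Λ'' e'' ≤ k' →
            (1 - (M₂ : ℝ) / M) * min (ρ L M' Λ' e') (ρ L M'' Λ'' e'') ≤ ρ L M Λ e ∧
            (1 - (M₂ : ℝ) / M) * min (κ L M' Λ' e') (κ L M'' Λ'' e'') ≤ κ L M Λ e ∧
            κ L M Λ e ≤ (1 + (M₂ : ℝ) / M) * max (κ L M' Λ' e') (κ L M'' Λ'' e'')) :
    ∀ (L M' M'' M : ℕ) [NeZero L] [NeZero M'] [NeZero M''] [NeZero M],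
      Even L → Even M' → Even M'' → M₂ ≤ M' → M₂ ≤ M'' → M' + M'' = M → M ≤ L → L₂ ≤ L →
        ∀ (Λ' : Type) [LinearOrder Λ'] [Fintype Λ'] (e' : Λ' ≃ ZMod L × ZMod M')
          (Λ'' : Type) [LinearOrder Λ''] [Fintype Λ''] (e'' : Λ'' ≃ ZMod L × ZMod M'')
          (Λ : Type) [LinearOrder Λ] [Fintype Λ] (e : Λ ≃ ZMod L × ZMod M),
          d' ≤ ρ L M' Λ' e' → d' ≤ ρ L M'' Λ'' e'' → d' ≤ κ L M' Λ' e' →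
          d' ≤ κ L M'' Λ'' e'' → κ L M' Λ' e' ≤ k' → κ L M'' Λ'' e'' ≤ k' →
            min (ρ L M' Λ' e') (ρ L M'' Λ'' e'') - M₂ * max R k' / M ≤ ρ L M Λ e ∧
            min (κ L M' Λ' e') (κ L M'' Λ'' e'') - M₂ * max R k' / M ≤ κ L M Λ e ∧
            κ L M Λ e ≤ max (κ L M' Λ' e') (κ L M'' Λ'' e'') + M₂ * max R k' / M := by
  intro L M' M'' M _ _ _ _ hLe hM'E hM''E h2M' h2M'' hsum hML hL₂L Λ' _ _ e' Λ'' _ _ e'' Λ _ _ e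
    hr' hr'' hk' hk'' hu' hu''
  obtain ⟨g1, g2, g3⟩ := hB L M' M'' M hLe hM'E hM''E h2M' h2M'' hsum hML hL₂L Λ' e' Λ'' e'' Λ e
    hr' hr'' hk' hk'' hu' hu''
  have hM0 : (0 : ℝ) < M := by exact_mod_cast Nat.pos_of_ne_zero (NeZero.ne M)
  have ha : (0 : ℝ) ≤ M₂ := by positivity
  have haM : 0 ≤ (M₂ : ℝ) / M := by positivity
  have hRle : R ≤ max R k' := le_max_left _ _
  have hkle : k' ≤ max R k' := le_max_right _ _
  have hρ'R : ρ L M' Λ' e' ≤ R := hR L M' h2M' hL₂L Λ' e'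
  set mρ := min (ρ L M' Λ' e') (ρ L M'' Λ'' e'') with hmρ
  set mκ := min (κ L M' Λ' e') (κ L M'' Λ'' e'') with hmκ
  set Mκ := max (κ L M' Λ' e') (κ L M'' Λ'' e'') with hMκ
  have hmρR : mρ ≤ max R k' := (min_le_left _ _).trans (hρ'R.trans hRle)
  have hmκk : mκ ≤ max R k' := (min_le_left _ _).trans (hu'.trans hkle)
  have hMκk : Mκ ≤ max R k' := (max_le hu' hu'').trans hkle
  have hMκ0 : 0 ≤ Mκ := (hd'.le.trans hk').trans (le_max_left _ _)
  have e1 : (M₂ : ℝ) * max R k' / M = (M₂ : ℝ) / M * max R k' := by ring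
  refine ⟨?_, ?_, ?_⟩
  · have h1 : (M₂ : ℝ) / M * mρ ≤ (M₂ : ℝ) / M * max R k' := mul_le_mul_of_nonneg_left hmρR haM
    have h2 : (1 - (M₂ : ℝ) / M) * mρ = mρ - (M₂ : ℝ) / M * mρ := by ring
    rw [e1]; linarith
  · have h1 : (M₂ : ℝ) / M * mκ ≤ (M₂ : ℝ) / M * max R k' := mul_le_mul_of_nonneg_left hmκk haM
    have h2 : (1 - (M₂ : ℝ) / M) * mκ = mκ - (M₂ : ℝ) / M * mκ := by ring
    rw [e1]; linarith
  · have h1 : (M₂ : ℝ) / M * Mκ ≤ (M₂ : ℝ) / M * max R k' := mul_le_mul_of_nonneg_left hMκk haM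
    have h2 : (1 + (M₂ : ℝ) / M) * Mκ = Mκ + (M₂ : ℝ) / M * Mκ := by ring
    rw [e1]; linarith

/-! ### Over the tube names, pointwise in `(U, δ)` -/

/-- **The same with a FLOORED MULTIPLICATIVE one-seam locality** (boundary factors `1 ∓ M₂/M` on
parts floored by `(d', k')`, constants `M₂(d',k'), L₂(d',k')`): by Bloch's a-priori bound
`ρ̃ ≤ 2` (`tubeStiffness_le_two`, `L ≥ 3`) it is an additive locality with `C = M₂·max(2, k')`
(`condAdditive_of_flooredMultiplicative`), so the additive induction applies. [folklore] -/
theorem uniformThermo_of_uniformConstants_of_flooredGluing (U δ : ℝ) {d k : ℝ} (hd : 0 < d) (m₁ : ℕ)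
    (hA : ∀ (M : ℕ) [NeZero M], Even M → m₁ ≤ M → ∃ L₁ : ℕ, ∀ (L : ℕ) [NeZero L], Even L → M ≤ L →
      L₁ ≤ L → ∀ (Λ : Type) [LinearOrder Λ] [Fintype Λ] (e : Λ ≃ ZMod L × ZMod M),
        d ≤ tubeStiffness L M Λ e U δ ∧ d ≤ tubePairCompressibility L M Λ e U δ ∧
          tubePairCompressibility L M Λ e U δ ≤ k)
    (hB : ∀ d' k' : ℝ, 0 < d' → ∃ M₂ L₂ : ℕ,
      ∀ (L M' M'' M : ℕ) [NeZero L] [NeZero M'] [NeZero M''] [NeZero M],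
        Even L → Even M' → Even M'' → M₂ ≤ M' → M₂ ≤ M'' → M' + M'' = M → M ≤ L → L₂ ≤ L →
        ∀ (Λ' : Type) [LinearOrder Λ'] [Fintype Λ'] (e' : Λ' ≃ ZMod L × ZMod M')
          (Λ'' : Type) [LinearOrder Λ''] [Fintype Λ''] (e'' : Λ'' ≃ ZMod L × ZMod M'')
          (Λ : Type) [LinearOrder Λ] [Fintype Λ] (e : Λ ≃ ZMod L × ZMod M),
          d' ≤ tubeStiffness L M' Λ' e' U δ → d' ≤ tubeStiffness L M'' Λ'' e'' U δ →
          d' ≤ tubePairCompressibility L M' Λ' e' U δ →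
          d' ≤ tubePairCompressibility L M'' Λ'' e'' U δ →
          tubePairCompressibility L M' Λ' e' U δ ≤ k' →
          tubePairCompressibility L M'' Λ'' e'' U δ ≤ k' →
            (1 - (M₂ : ℝ) / M) *
                min (tubeStiffness L M' Λ' e' U δ) (tubeStiffness L M'' Λ'' e'' U δ) ≤
              tubeStiffness L M Λ e U δ ∧
            (1 - (M₂ : ℝ) / M) *
                min (tubePairCompressibility L M' Λ' e' U δ) (tubePairCompressibility L M'' Λ'' e'' U δ) ≤
              tubePairCompressibility L M Λ e U δ ∧
            tubePairCompressibility L M Λ e U δ ≤ (1 + (M₂ : ℝ) / M) *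
                max (tubePairCompressibility L M' Λ' e' U δ) (tubePairCompressibility L M'' Λ'' e'' U δ)) :
    ∃ d₀ : ℝ, 0 < d₀ ∧ ∃ k₀ : ℝ, ∃ M₁ L₀ : ℕ, UniformThermo U δ d₀ k₀ M₁ L₀ := by
  refine uniformThermo_of_uniformConstants_of_condAdditive U δ hd m₁ hA ?_
  intro d' k' hd'
  obtain ⟨M₂, L₂, hB⟩ := hB d' k' hd'
  refine ⟨M₂ * max 2 k', by positivity, M₂, max L₂ 3, ?_⟩
  have hR : ∀ (L M : ℕ) [NeZero L] [NeZero M], M₂ ≤ M → max L₂ 3 ≤ L →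
      ∀ (Λ : Type) [LinearOrder Λ] [Fintype Λ] (e : Λ ≃ ZMod L × ZMod M),
        (fun (L M : ℕ) [NeZero L] [NeZero M] (Λ : Type) [LinearOrder Λ] [Fintype Λ]
          (e : Λ ≃ ZMod L × ZMod M) => tubeStiffness L M Λ e U δ) L M Λ e ≤ 2 :=
    fun L M _ _ _ hL Λ _ _ e => tubeStiffness_le_two L M Λ e ((le_max_right _ _).trans hL) U δ
  have hB3 : ∀ (L M' M'' M : ℕ) [NeZero L] [NeZero M'] [NeZero M''] [NeZero M],
      Even L → Even M' → Even M'' → M₂ ≤ M' → M₂ ≤ M'' → M' + M'' = M → M ≤ L → max L₂ 3 ≤ L →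
        ∀ (Λ' : Type) [LinearOrder Λ'] [Fintype Λ'] (e' : Λ' ≃ ZMod L × ZMod M')
          (Λ'' : Type) [LinearOrder Λ''] [Fintype Λ''] (e'' : Λ'' ≃ ZMod L × ZMod M'')
          (Λ : Type) [LinearOrder Λ] [Fintype Λ] (e : Λ ≃ ZMod L × ZMod M),
          d' ≤ tubeStiffness L M' Λ' e' U δ → d' ≤ tubeStiffness L M'' Λ'' e'' U δ →
          d' ≤ tubePairCompressibility L M' Λ' e' U δ →
          d' ≤ tubePairCompressibility L M'' Λ'' e'' U δ →
          tubePairCompressibility L M' Λ' e' U δ ≤ k' →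
          tubePairCompressibility L M'' Λ'' e'' U δ ≤ k' →
            (1 - (M₂ : ℝ) / M) *
                min (tubeStiffness L M' Λ' e' U δ) (tubeStiffness L M'' Λ'' e'' U δ) ≤
              tubeStiffness L M Λ e U δ ∧
            (1 - (M₂ : ℝ) / M) *
                min (tubePairCompressibility L M' Λ' e' U δ) (tubePairCompressibility L M'' Λ'' e'' U δ) ≤
              tubePairCompressibility L M Λ e U δ ∧
            tubePairCompressibility L M Λ e U δ ≤ (1 + (M₂ : ℝ) / M) *
                max (tubePairCompressibility L M' Λ' e' U δ) (tubePairCompressibility L M'' Λ'' e'' U δ) :=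
    fun L M' M'' M _ _ _ _ hLe hM'E hM''E h2M' h2M'' hsum hML hL Λ' _ _ e' Λ'' _ _ e'' Λ _ _ e =>
      hB L M' M'' M hLe hM'E hM''E h2M' h2M'' hsum hML ((le_max_left _ _).trans hL) Λ' e' Λ'' e'' Λ e
  exact condAdditive_of_flooredMultiplicative (fun L M _ _ Λ _ _ e => tubeStiffness L M Λ e U δ)
    (fun L M _ _ Λ _ _ e => tubePairCompressibility L M Λ e U δ) hd' M₂ (max L₂ 3) hR hB3

/-! ### The target of route `SeamInduction` -/

/-- **The target from uniform constants per width plus a FLOORED MULTIPLICATIVE one-seam locality**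
(the guarded repair "boundary factors `1 ∓ M₂/M` claimed only for parts floored by `(d, k)`, with
`M₂, L₂` free to depend on `(U, δ, d, k)`"): also sufficient for
`SeamInduction.WidthUniformThermodynamics`, through Bloch's bound and the additive induction.
[folklore] -/
theorem seamInduction_widthUniformThermodynamics_of_uniformConstants_of_flooredGluing
    (hA : ∃ U : ℝ, 0 < U ∧ ∃ δ ∈ Set.Ioo (0 : ℝ) (3 / 10), ∃ d : ℝ, 0 < d ∧ ∃ k : ℝ, ∃ m₁ : ℕ,
      ∀ (M : ℕ) [NeZero M], Even M → m₁ ≤ M → ∃ L₁ : ℕ, ∀ (L : ℕ) [NeZero L], Even L → M ≤ L →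
        L₁ ≤ L → ∀ (Λ : Type) [LinearOrder Λ] [Fintype Λ] (e : Λ ≃ ZMod L × ZMod M),
          d ≤ tubeStiffness L M Λ e U δ ∧ d ≤ tubePairCompressibility L M Λ e U δ ∧
            tubePairCompressibility L M Λ e U δ ≤ k)
    (hB : ∀ U : ℝ, 0 < U → ∀ δ ∈ Set.Ioo (0 : ℝ) (3 / 10), ∀ d k : ℝ, 0 < d → ∃ M₂ L₂ : ℕ,
      ∀ (L M' M'' M : ℕ) [NeZero L] [NeZero M'] [NeZero M''] [NeZero M],
        Even L → Even M' → Even M'' → M₂ ≤ M' → M₂ ≤ M'' → M' + M'' = M → M ≤ L → L₂ ≤ L →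
        ∀ (Λ' : Type) [LinearOrder Λ'] [Fintype Λ'] (e' : Λ' ≃ ZMod L × ZMod M')
          (Λ'' : Type) [LinearOrder Λ''] [Fintype Λ''] (e'' : Λ'' ≃ ZMod L × ZMod M'')
          (Λ : Type) [LinearOrder Λ] [Fintype Λ] (e : Λ ≃ ZMod L × ZMod M),
          d ≤ tubeStiffness L M' Λ' e' U δ → d ≤ tubeStiffness L M'' Λ'' e'' U δ →
          d ≤ tubePairCompressibility L M' Λ' e' U δ →
          d ≤ tubePairCompressibility L M'' Λ'' e'' U δ →
          tubePairCompressibility L M' Λ' e' U δ ≤ k →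
          tubePairCompressibility L M'' Λ'' e'' U δ ≤ k →
            (1 - (M₂ : ℝ) / M) *
                min (tubeStiffness L M' Λ' e' U δ) (tubeStiffness L M'' Λ'' e'' U δ) ≤
              tubeStiffness L M Λ e U δ ∧
            (1 - (M₂ : ℝ) / M) *
                min (tubePairCompressibility L M' Λ' e' U δ) (tubePairCompressibility L M'' Λ'' e'' U δ) ≤
              tubePairCompressibility L M Λ e U δ ∧
            tubePairCompressibility L M Λ e U δ ≤ (1 + (M₂ : ℝ) / M) *
                max (tubePairCompressibility L M' Λ' e' U δ) (tubePairCompressibility L M'' Λ'' e'' U δ)) :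
    Summit.HubbardSuperconductivity.HubbardSuperconductivity.Theses.SeamInduction.WidthUniformThermodynamics := by
  refine seamInduction_widthUniformThermodynamics_iff.2 (widthUniformThermodynamics_iff.2 ?_)
  obtain ⟨U, hU, δ, hδ, d, hd, k, m₁, hA⟩ := hA
  obtain ⟨d₀, hd₀, k₀, M₁, L₀, h⟩ :=
    uniformThermo_of_uniformConstants_of_flooredGluing U δ hd m₁ hA (hB U hU δ hδ)
  exact ⟨U, hU, δ, hδ, d₀, hd₀, k₀, M₁, L₀, h⟩

end Summit.HubbardSuperconductivity.HubbardSuperconductivity.Theorems.WidthUniformThermodynamics
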